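import Summits.MatrixMultiplication.OmegaCensus.STPP222Pow5Cyclic
import Summits.MatrixMultiplication.OmegaCensus.STPP222Pow5CyclicWitnessesB
import Summits.MatrixMultiplication.OmegaCensus.STPP222Pow5CyclicWitnesses9294

/-!
# ω-census, STPP pattern `(2,2,2)⁵` in cyclic groups: the laws `m ≥ 94`, `m ≥ 92 ∧ m ≠ 93`, and `m even ≥ 84` (glue)

HONEST FRAMING (pub-omega census; verbatim): lottery ticket; floor = certified bounds/negative ranges.
Census STRUCTURE bookkeeping (question Q7 / P-022 / P-024: the cyclic onset `m₅` of five simultaneous-TPP triples of 2-subsets,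
CKSU 2005 Def. 5.1, tree form `IsSTPP`), not progress on `ω` (`5 · 2^ω ≤ 84` reads `ω ≤ 4.1`).

Glue only, no new search: `STPP222Pow5CyclicWitnesses9294.lean` (`ℤ/92`, `ℤ/94` and its appendix `ℤ/80, 84, 86, 88, 90`; seat
pub-omega-stpp-3, involution-restricted sub-search `t4inv`, kit j214393) + `STPP222Pow5CyclicWitnessesB.lean` (`ℤ/95 … ℤ/99`; seat
pub-omega ENG1, `c4x` discovery sweeps, kit j206259/j206964/j212302) + `STPP222Pow5Cyclic.lean` (`exists_isSTPP_2225_zmod_of_le100`: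
`ℤ/100 … ℤ/129` kernel witnesses and an integer witness for every `m ≥ 130`; seat pub-omega-stpp-3)
⇒ `(2,2,2)⁵ ⊆ ℤ/m` for every `m ≥ 94`, for every `m ≥ 92` except possibly `m = 93`, and for every EVEN `m ≥ 84`; plus the
exponent transports to finite abelian groups.
NOT claimed: `ℤ/93`, `ℤ/82`, any odd `m ≤ 91`, any `m ≤ 79` (capped census probes of 2026-08-24 decide nothing; `ℤ/80` itself IS
known, `exists_isSTPP_222pow5_zmod80`, but with `ℤ/82` undecided no ray from `80` is stated here), minimality of any threshold, or
monotonicity in `m` (the least order of ANY abelian group with `(2,2,2)⁵` is `≤ 72`, `STPP222PentaOrder72.lean`).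

References: H. Cohn, R. Kleinberg, B. Szegedy, C. Umans, FOCS 2005 (arXiv:math/0511460), Def. 5.1.  Cell records: pub-omega HOME
`STATUS.md` 2026-08-24 (stpp-3 gen 8 04:31Z–08:31Z; ENG1 gen 16 03:50Z–08:44Z), `code/eng1/results/stpp/p020/kit-j212302/`,
`pub-omega-stpp-3-g8/results/kit-j214393/`, pre-registration `prereg/P-024.md`.
-/

open Literature.Computability.AlgebraicComplexity Finset

namespace Summit.MatrixMultiplication.OmegaCensus

/-- **`(2,2,2)⁵ ⊆ ℤ/m` for every `m ≥ 94`**: `ℤ/94` (`exists_isSTPP_222pow5_zmod94`), `ℤ/95 … ℤ/99` (`STPP222Pow5CyclicWitnessesB.lean`),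
`m ≥ 100` (`exists_isSTPP_2225_zmod_of_le100`).  No minimality claimed. [cite: CohnKleinbergSzegedyUmans2005, Def. 5.1] -/
theorem exists_isSTPP_2225_zmod_of_le94 (m : ℕ) (hm : 94 ≤ m) :
    ∃ A B C : Fin 5 → Finset (ZMod m), IsSTPP A B C ∧ ∀ i, (A i).card = 2 ∧ (B i).card = 2 ∧ (C i).card = 2 := by
  by_cases h : 100 ≤ m
  · exact exists_isSTPP_2225_zmod_of_le100 m h
  · interval_cases m
    · exact exists_isSTPP_222pow5_zmod94
    · exact exists_isSTPP_222pow5_zmod95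
    · exact exists_isSTPP_222pow5_zmod96
    · exact exists_isSTPP_222pow5_zmod97
    · exact exists_isSTPP_222pow5_zmod98
    · exact exists_isSTPP_222pow5_zmod99

/-- **`(2,2,2)⁵ ⊆ ℤ/m` for every `m ≥ 92` other than `m = 93`** (`ℤ/92` by `exists_isSTPP_222pow5_zmod92`, `m ≥ 94` by
`exists_isSTPP_2225_zmod_of_le94`).  `ℤ/93` is OPEN (not claimed either way). [cite: CohnKleinbergSzegedyUmans2005, Def. 5.1] -/
theorem exists_isSTPP_2225_zmod_of_le92_ne93 (m : ℕ) (hm : 92 ≤ m) (h93 : m ≠ 93) :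
    ∃ A B C : Fin 5 → Finset (ZMod m), IsSTPP A B C ∧ ∀ i, (A i).card = 2 ∧ (B i).card = 2 ∧ (C i).card = 2 := by
  by_cases h : 94 ≤ m
  · exact exists_isSTPP_2225_zmod_of_le94 m h
  · interval_cases m
    · exact exists_isSTPP_222pow5_zmod92
    · exact absurd rfl h93

/-- Transport: every finite abelian group of exponent `≥ 94` admits `(2,2,2)⁵` (an element of order `= exponent` spans a copy of
`ℤ/m`, `m ≥ 94`). [cite: CohnKleinbergSzegedyUmans2005, Def. 5.1] -/
theorem exists_isSTPP_2225_of_exponent_ge94 {G : Type*} [AddCommGroup G] [Finite G]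
    (h : 94 ≤ AddMonoid.exponent G) :
    ∃ A B C : Fin 5 → Finset G, IsSTPP A B C ∧ ∀ i, (A i).card = 2 ∧ (B i).card = 2 ∧ (C i).card = 2 := by
  obtain ⟨g, hg⟩ := AddMonoid.exists_addOrderOf_eq_exponent (AddMonoid.ExponentExists.of_finite (G := G))
  exact exists_isSTPP_222pow_of_injective _ (zmod_lift_zmultiples_injective g)
    (exists_isSTPP_2225_zmod_of_le94 _ (by rw [hg]; exact h))

/-- Transport: every finite abelian group whose exponent is `≥ 92` and `≠ 93` admits `(2,2,2)⁵`.
[cite: CohnKleinbergSzegedyUmans2005, Def. 5.1] -/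
theorem exists_isSTPP_2225_of_exponent_ge92_ne93 {G : Type*} [AddCommGroup G] [Finite G]
    (h : 92 ≤ AddMonoid.exponent G) (h93 : AddMonoid.exponent G ≠ 93) :
    ∃ A B C : Fin 5 → Finset G, IsSTPP A B C ∧ ∀ i, (A i).card = 2 ∧ (B i).card = 2 ∧ (C i).card = 2 := by
  obtain ⟨g, hg⟩ := AddMonoid.exists_addOrderOf_eq_exponent (AddMonoid.ExponentExists.of_finite (G := G))
  exact exists_isSTPP_222pow_of_injective _ (zmod_lift_zmultiples_injective g)
    (exists_isSTPP_2225_zmod_of_le92_ne93 _ (by rw [hg]; exact h) (by rw [hg]; exact h93))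

/-! ## The even ray from `84`

With the appendix of `STPP222Pow5CyclicWitnesses9294.lean` (`ℤ/80, 84, 86, 88, 90`, kit j214393 of seat pub-omega-stpp-3, each an
involution/coset family found by the restricted mode `--inv 5`), every EVEN modulus `m ≥ 84` is covered.  `ℤ/82` is undecided, so
the ray is stated from `84`, not from `80` (`ℤ/80` alone is `exists_isSTPP_222pow5_zmod80`). -/

/-- **`(2,2,2)⁵ ⊆ ℤ/m` for every EVEN `m ≥ 84`**: `ℤ/84, 86, 88, 90` (`exists_isSTPP_222pow5_zmod84 … zmod90`), `ℤ/92` and every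
`m ≥ 94` (`exists_isSTPP_2225_zmod_of_le92_ne93`; `93` is odd).  No minimality claimed; `ℤ/82` and every odd `m ≤ 93` are UNDECIDED.
[cite: CohnKleinbergSzegedyUmans2005, Def. 5.1] -/
theorem exists_isSTPP_2225_zmod_of_even_le84 (m : ℕ) (hm : 84 ≤ m) (heven : Even m) :
    ∃ A B C : Fin 5 → Finset (ZMod m), IsSTPP A B C ∧ ∀ i, (A i).card = 2 ∧ (B i).card = 2 ∧ (C i).card = 2 := by
  by_cases h : 92 ≤ m
  · refine exists_isSTPP_2225_zmod_of_le92_ne93 m h fun h93 => ?_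
    subst h93
    exact absurd heven (by decide)
  · interval_cases m
    · exact exists_isSTPP_222pow5_zmod84
    · exact absurd heven (by decide)
    · exact exists_isSTPP_222pow5_zmod86
    · exact absurd heven (by decide)
    · exact exists_isSTPP_222pow5_zmod88
    · exact absurd heven (by decide)
    · exact exists_isSTPP_222pow5_zmod90
    · exact absurd heven (by decide)

/-- Transport: every finite abelian group whose exponent is EVEN and `≥ 84` (equivalently: of even order with exponent `≥ 84`)
admits `(2,2,2)⁵`. [cite: CohnKleinbergSzegedyUmans2005, Def. 5.1] -/
theorem exists_isSTPP_2225_of_exponent_even_ge84 {G : Type*} [AddCommGroup G] [Finite G]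
    (h : 84 ≤ AddMonoid.exponent G) (heven : Even (AddMonoid.exponent G)) :
    ∃ A B C : Fin 5 → Finset G, IsSTPP A B C ∧ ∀ i, (A i).card = 2 ∧ (B i).card = 2 ∧ (C i).card = 2 := by
  obtain ⟨g, hg⟩ := AddMonoid.exists_addOrderOf_eq_exponent (AddMonoid.ExponentExists.of_finite (G := G))
  exact exists_isSTPP_222pow_of_injective _ (zmod_lift_zmultiples_injective g)
    (exists_isSTPP_2225_zmod_of_even_le84 _ (by rw [hg]; exact h) (by rw [hg]; exact heven))

end Summit.MatrixMultiplication.OmegaCensus
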